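import Mathlib
import Literature.AlgebraicGeometry.Resolution.CobordantGame

/-!
# [OURS · L1 W4.3] Track C of the engine crux `LocalWeightedDrop`: definitions (Cohen frames, total transform, `WonAt`)

Route `ResolutionOfSingularities/WeightedInvariant`, crux `LocalWeightedDrop` (stmt-ResolutionOfSingularities-8899),
TRACK C (chain w43, CHAIN.md v3; typed target `TrackC.surfaceGermsWon_of_CJSSequence`, plan-1 evidence #58;
skeleton `L/res-L1-w43-stub-4/TrackC_Skeleton.lean`, res-L1-w43-stub-4). Our construction programme — NOT a
statement of any manuscript.

The conditional N = 3 milestone follows the Cossart–Jannsen–Saito blow-up SEQUENCE of `V(f) ⊆ Z₀ = Spec k⟦x₀,x₁,x₂⟧`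
along the branch of closed points chosen by the Refuter of the local weighted resolution game. The bookkeeping
objects of that induction are defined here (so that the step / end / base lemmas can be landed as separate files):

* `stalkConst σ z` — the constants `k → 𝒪_{Z,z}` of a `Z₀`-scheme `σ : Z ⟶ Z₀`;
* `totalGerm σ z f` — the germ at `z` of the total transform `σ♯ f` of `f ∈ k⟦x⟧ = Γ(Z₀, 𝒪_{Z₀})`;
* `Frame σ z` — a COHEN FRAME at `z`: a ring isomorphism `𝒪̂_{Z,z} ≃ k⟦X₀,X₁,X₂⟧` of the `𝔪`-adic completion of
  the (Noetherian) local ring taking constants to constants;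
* `WonAt f σ` — at every framed point of `Z`, every SINGULAR germ DIVIDING the total transform of `f` (read in
  the frame) is won in the game `CobordantGame.Won k 3` — the game germ is the saturated transform, the divided-out
  exceptional monomials being the cofactor.
-/

noncomputable section

open CategoryTheory AlgebraicGeometry TopologicalSpace IsLocalRing
open Literature.AlgebraicGeometry.Resolution

set_option linter.dupNamespace false -- mandated namespace of this single-conjunct summit

namespace Summit.ResolutionOfSingularities.ResolutionOfSingularities.Theorems.TrackC

variable {k : Type} [Field k]

/-- **Constants.** The ring map `k → 𝒪_{Z,z}` of a scheme `σ : Z ⟶ Z₀ = Spec k⟦x₀,x₁,x₂⟧`: a constant `a` is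
the global section `σ♯(a)` of `Z` (through `k → k⟦x⟧ = Γ(Z₀, 𝒪)`), taken to its germ at `z`. [OURS · folklore] -/
def stalkConst {Z : Scheme.{0}} (σ : Z ⟶ Spec (.of (MvPowerSeries (Fin 3) k))) (z : Z) :
    k →+* Z.presheaf.stalk z :=
  (Z.presheaf.germ ⊤ z trivial).hom.comp
    ((σ.appTop.hom.comp (Scheme.ΓSpecIso (.of (MvPowerSeries (Fin 3) k))).inv.hom).comp
      (MvPowerSeries.C : k →+* MvPowerSeries (Fin 3) k))

/-- **Total transform.** The germ at `z ∈ Z` of the pull-back `σ♯ f ∈ Γ(Z, 𝒪_Z)` of `f ∈ k⟦x₀,x₁,x₂⟧ = Γ(Z₀, 𝒪)`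
along `σ : Z ⟶ Z₀`. [OURS · folklore] -/
def totalGerm {Z : Scheme.{0}} (σ : Z ⟶ Spec (.of (MvPowerSeries (Fin 3) k))) (z : Z)
    (f : MvPowerSeries (Fin 3) k) : Z.presheaf.stalk z :=
  (Z.presheaf.germ ⊤ z trivial).hom (σ.appTop.hom ((Scheme.ΓSpecIso (.of (MvPowerSeries (Fin 3) k))).inv.hom f))

/-- **Cohen frame** at a point `z` of a `Z₀`-scheme with Noetherian local ring: a ring isomorphism of the
`𝔪_z`-adic completion `𝒪̂_{Z,z}` with `k⟦X₀,X₁,X₂⟧` taking the constants `k` to the constants (Cohen's structure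
theorem for the complete regular local `k`-algebras `𝒪̂_{Z,z}` with residue field `k`, in coordinates of our
choosing). [OURS · folklore] -/
structure Frame {Z : Scheme.{0}} (σ : Z ⟶ Spec (.of (MvPowerSeries (Fin 3) k))) (z : Z)
    [IsNoetherianRing (Z.presheaf.stalk z)] where
  /-- the Cohen isomorphism `𝒪̂_{Z,z} ≃ k⟦X₀,X₁,X₂⟧` -/
  e : AdicCompletion (maximalIdeal (Z.presheaf.stalk z)) (Z.presheaf.stalk z) ≃+* MvPowerSeries (Fin 3) k
  /-- constants go to constants -/
  map_const : ∀ a : k, e (algebraMap _ _ (stalkConst σ z a)) = MvPowerSeries.C a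

/-- **`WonAt f σ`.** At every framed point `z` of the `Z₀`-scheme `σ : Z ⟶ Z₀` (frames exist exactly at the
`k`-points with regular three-dimensional local ring), every SINGULAR germ `g ∈ k⟦X₀,X₁,X₂⟧` dividing the total
transform of `f` read in the frame is won in the local weighted resolution game in three variables.
[OURS · folklore] -/
def WonAt (f : MvPowerSeries (Fin 3) k) {Z : Scheme.{0}} (σ : Z ⟶ Spec (.of (MvPowerSeries (Fin 3) k))) :
    Prop :=
  ∀ (z : Z) (hN : IsNoetherianRing (Z.presheaf.stalk z)) (F : @Frame k _ Z σ z hN)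
    (g : MvPowerSeries (Fin 3) k),
    g ∣ F.e (algebraMap _ _ (totalGerm σ z f)) → CobordantGame.IsSingular k g → CobordantGame.Won k 3 g

end Summit.ResolutionOfSingularities.ResolutionOfSingularities.Theorems.TrackC

end
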